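import Summits.ResolutionOfSingularities.ResolutionOfSingularities.Theses.EquisingularLift
import Summits.ResolutionOfSingularities.ResolutionOfSingularities.Theses.TeissierJung
import Summits.ResolutionOfSingularities.ResolutionOfSingularities.Theorems.WeightedInvariantWeightedThesisHypersurfaceModelInfinite
import Summits.ResolutionOfSingularities.ResolutionOfSingularities.Theorems.WeightedInvariantWeightedThesisImageLocallyPrincipal
import Literature.AlgebraicGeometry.Motives.ProjectiveNoetherNormalization
import Summits.ResolutionOfSingularities.ResolutionOfSingularities.Theorems.WeightedInvariantWeightedThesisProjectiveIntegralSuffices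
import Summits.ResolutionOfSingularities.ResolutionOfSingularities.Theorems.WeightedInvariantWeightedThesisFiniteBirationalTransfer
import Summits.ResolutionOfSingularities.ResolutionOfSingularities.Theorems.WeightedThesis.Negative.LoadBearing
import Literature.AlgebraicGeometry.Resolution.KollarBlowupSequenceFunctorsProofs
import Literature.AlgebraicGeometry.Resolution.NonReducedNoResolution
import Literature.AlgebraicGeometry.Resolution.AbsoluteIntegralClosureNoResolution
import Literature.AlgebraicGeometry.Resolution.ProjectiveSpaceRegular
import Literature.AlgebraicGeometry.Motives.VarietiesProperProofs

/-!
# Disproof of `HypersurfacesSuffice` (crux stmt-ResolutionOfSingularities-15964) — findings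

Standing adversary work file (cdisprove, gen 1; v1 cycle 1, v2 cycle 2 = re-arm on the registered
skeleton `generic-projection-closure`, 2026-08-17; refuter-cdisprove-stmt-ResolutionOfSingularities-15964-0).
Prose only in docstrings; §§0–6 and the theorems of §7 are sorry-free; the ONLY `sorry`s are the three
labelled NEAR-MISSES of §7 (informal witnesses for the load-bearing hypotheses of stub S2, not live).

LANDED (importable): §2 + §5 (with the characteristic-0 antecedent lemma of §1) as the negative-lemma
module `Summits.ResolutionOfSingularities.ResolutionOfSingularities.Theorems.HypersurfacesSuffice.Negative.LoadBearing`
(p150526 ACCEPTED 2026-08-17, commit 404590d1fddf): `antecedent_of_charZero`,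
`hypersurfacesSuffice_without_isReduced_iff`, `hypersurfacesSuffice_false_without_isReduced`,
`hypersurfacesSuffice_without_locallyOfFiniteType_iff`,
`hypersurfacesSuffice_false_without_locallyOfFiniteType`, `hypersurfacesSuffice_strengthening_isRegular_false`
(+ `aic_*`, `not_hasResolution_spec_aic` over any field). The POSITIVE proof of §6 is attached to the
item as evidence `CandidateProof.lean` (2026-08-17T08:55Z) for a prover to land; the lead's picked line
is closed sorry-free in evidence `LineClosure.lean` (2026-08-17T09:25Z: stub S2 proved, glue replayed on
the landed S1/S3/S4) — see §7.

THE CRUX (routes EquisingularLift r4, TeissierJung r4; identical bodies).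
`HypersurfacesSuffice := ∀ k [Field k] [IsAlgClosed k], HypRes k → ResOver k` (`crux_iff`, `Iff.rfl`)
with `HypRes k` = every INTEGRAL CLOSED `H ⊆ ℙᵐ_k` whose ideal is PRINCIPAL on an affine
neighbourhood of every point of `ℙᵐ_k` has a resolution (`Scheme.HasResolution`: proper, iso over a
dense open with dense preimage, regular source), and `ResOver k` = every reduced separated
`k`-scheme of finite type has a resolution (`= ResolutionInChar` at the one field `k`).

VERDICT: NO KILL IS POSSIBLE — THE CRUX IS A THEOREM, PROVED IN §6 OF THIS FILE
(`crux_proved`, `crux_proved_teissierJung`; axioms propext / Classical.choice / Quot.sound; the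
same text is attached to the item as evidence `CandidateProof.lean` for a prover to land under
`Theorems/` — a refuter may not land positive items).

FINDINGS.
* §1 WEB. `ResOver k → HypRes k` over every field (`hypRes_of_resOver`; `ℙᵐ_k → Spec k` proper), so
  the crux says `HypRes k ↔ ResOver k` for `k = k̄`. Characteristic `0` is FREE: Hironaka's theorem
  is PROVED in the tree (`Hironaka1964_holds`, standard axioms), whence `resOver_of_charZero`,
  `hypRes_of_charZero` (the antecedent is SATISFIABLE — non-vacuity), `crux_iff_charP` (the crux is
  equivalent to its positive-characteristic part, the only part `closes` consumes) and
  `crux_of_summit` (summit ⇒ crux: the crux is a weakening of the summit, as a reduction must be).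
  The mutation "drop local principality from the antecedent" is the tree theorem
  `stub_projectiveIntegralSuffices` (`withoutLocallyPrincipal_holds`, every field): the live
  content was only the hypersurface-MODEL step, isolated as `ClosedHypersurfaceModels k` with
  `crux_of_closedHypersurfaceModels` — and discharged in §6.
* §2 LOAD-BEARING HYPOTHESES OF THE CONSEQUENT, as UNCONDITIONAL theorems (new — possible because
  `HypRes ℚ̄` is a theorem): `IsReduced X` dropped ⇒ the crux becomes "hypersurface resolution
  fails over EVERY algebraically closed field" (`withoutIsReduced_iff`, witness `Spec k[ε]`), hence
  FALSE (`hypersurfacesSuffice_false_without_isReduced`, at `k = ℚ̄`); `LocallyOfFiniteType f`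
  dropped ⇒ same (`withoutLocallyOfFiniteType_iff`, witness `Spec k[X]⁺`, the absolute integral
  closure of `k[X]` — the tree's `𝔽_p`-witness re-proved over an arbitrary field, `aic_*`,
  `not_hasResolution_spec_aic`), hence FALSE (`hypersurfacesSuffice_false_without_locallyOfFiniteType`).
  `IsSeparated` / `QuasiCompact` dropped: not cheaply attackable (recorded, trivial direction
  only; `QuasiCompact` is plausibly unnecessary).
* §3 ANTECEDENT CLASS. Modulo the named fact `CossartPiltant2019` the crux is equivalent to its
  form asking resolution only of hypersurfaces of dimension `≥ 4` (`crux_iff_dimGeFour`); with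
  `crux_iff_charP`: content lives exactly in char `p > 0`, `dim H ≥ 4` (the DimensionFourFrontier
  regime). Dropping `IsAlgClosed` (every field / perfect fields): implies the crux, not refutable
  here; §6 proves the PERFECT + INFINITE case on the way (`closedHypersurfaceModels_of_infinite`
  needs only that); over FINITE fields the tree's model is a hypersurface of `ℙᵈ × ℙ¹`
  (`stub_finiteFieldBranch_of_parts`), and whether the `ℙᵐ`-form holds there is not settled;
  over IMPERFECT fields a generic linear projection need not be birational. Dropping `IsIntegral H`
  from the antecedent would make it FALSE outright (non-reduced hypersurfaces `V(x₀²) ⊆ ℙ¹` have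
  no resolution, cf. `not_hasResolution_spec_dualNumber`) and the crux VACUOUSLY true — the
  integrality clause is what keeps the crux honest (and it matches what `EquisingularLift`
  supplies); not formalised (closed subschemes of `Proj` by homogeneous ideals are not in Mathlib).
* §4 DEGENERATE INSTANCES do not bite: `H = ℙᵐ` (kernel `⊥`, principal; regular), `X = ∅`,
  binders jointly satisfiable with a TRUE antecedent (`binders_satisfiable`, `k = ℚ̄`).
* §5 STRENGTHENING "consequent gives `X` regular" is FALSE unconditionally
  (`strengthening_isRegular_false`: `k = ℚ̄`, the cuspidal cubic, via the tree's
  `WeightedThesis.Negative.not_isRegular_spec_cusp`).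
* §6 THE CRUX PROVED: `closedHypersurfaceModel_of_linearForms` (any field: the scheme-theoretic
  image IN `ℙ^{d+1}` of the linear projection `(t₀:…:t_{d+1}) : X → ℙ^{d+1}` is an integral CLOSED
  hypersurface with locally principal ideal — `HypersurfaceModel.imageLocallyPrincipal`, prime
  divisors on the regular `ℙ^{d+1}` are Cartier, no punctured cone / vertex projection needed — and
  `X → H` is finite birational), `closedHypersurfaceModels_of_infinite` (generic forms over an
  infinite perfect field: the proof of `hypersurfaceModel_infinite_of_stubs` verbatim with its last
  line changed), `crux_proved` (`stub_projectiveIntegralSuffices` + models +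
  `stub_finiteBirationalTransfer`; `k̄` is perfect and infinite, no characteristic split).
* §7 TARGETS (cycle 2): the registered skeleton `generic-projection-closure` (S1 p150098, S3 p150482,
  S4 p150467 landed; S2 open with the lead). S2 is TRUE and PROVED (`target_S2`, registered signature;
  `target_S2_everywhere`, both vertex hypotheses dropped, any field — `imageLocallyPrincipal` on
  `ℙ^{d+1}`), S3 is redundant for integral `X` (`target_S3_of_integral`), joint sufficiency holds
  (LineClosure.lean closes the line); load-bearing hypotheses of S2 = dimension, image dimension,
  integrality (near-misses with informal witnesses); S1 needs `Infinite k` (plane-filling smooth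
  surface over `𝔽_q`, informal). No stub is false; payload `stuck_stubs = []`.

BARRIER CATALOGUE (`Literature/Barriers/ResolutionOfSingularities/`): no entry concerns the
reduction "hypersurfaces suffice" (DimensionFourFrontier, Narasimhan, Kangaroo, ResidualOrder,
InseparableBaseChange, QuasiExcellenceNecessary, LocalMonomializationFails all bear on resolution
STRATEGIES or on non-closed / imperfect ground fields); `ledger negatives` for the summit lists no
refuted statement of this shape. Consistent with §6.

WHY IT RESISTS: it is true, and now proved twice (§6; §7/LineClosure.lean along the lead's own line).
Consequence for the routes: in `closes` of EquisingularLift / TeissierJung the hypothesis `hHS` can be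
discharged by `crux_proved`; the routes' open content is entirely in their other cruxes
(EquisingularLift; TeissierReduction; the Descent pair). For the lead: land S2 as
`target_S2_everywhere` + corollary (6 lines, imports `…WeightedThesisImageLocallyPrincipal`), then the
assembly; nothing in this file obstructs any stub as stated.
-/

noncomputable section

open CategoryTheory AlgebraicGeometry TopologicalSpace
open Literature.AlgebraicGeometry.Resolution Literature.AlgebraicGeometry.Motives
open Summit.ResolutionOfSingularities.ResolutionOfSingularities.Theses.EquisingularLift
open Summit.ResolutionOfSingularities.ResolutionOfSingularities.Theorems.WeightedThesis

set_option linter.dupNamespace false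

namespace Summit.ResolutionOfSingularities.ResolutionOfSingularities.Cruxes.HypersurfacesSuffice.Disproof

/-! ## §0 The crux by name -/

/-- Resolution of HYPERSURFACES over `k`: every integral closed `H ⊆ ℙᵐ_k` whose ideal sheaf is
principal on an affine neighbourhood of every point of `ℙᵐ_k` has a resolution (the antecedent of
the crux, verbatim). -/
def HypRes (k : Type) [Field k] : Prop :=
  ∀ (m : ℕ) (H : Scheme.{0}) (ι' : H ⟶ (projectiveSpace m k).left), IsClosedImmersion ι' →
    IsIntegral H →
    (∀ y : (projectiveSpace m k).left, ∃ U : (projectiveSpace m k).left.affineOpens,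
      y ∈ (U : (projectiveSpace m k).left.Opens) ∧ (ι'.ker.ideal U).IsPrincipal) →
    Scheme.HasResolution H

/-- Resolution over `k`: every reduced separated `k`-scheme of finite type has a resolution (the
consequent of the crux, verbatim; = `ResolutionInChar` at one field). -/
def ResOver (k : Type) [Field k] : Prop :=
  ∀ (X : Scheme.{0}) (f : X ⟶ Spec (.of k)), IsSeparated f → LocallyOfFiniteType f →
    QuasiCompact f → IsReduced X → Scheme.HasResolution X

/-- The crux is `∀ k alg. closed, HypRes k → ResOver k`, definitionally. -/
theorem crux_iff :
    HypersurfacesSuffice ↔ ∀ (k : Type) [Field k] [IsAlgClosed k], HypRes k → ResOver k :=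
  Iff.rfl

/-! ## §1 Position in the implication web; what the tree already proves -/

/-- The converse direction is free over EVERY field: a hypersurface of `ℙᵐ_k` is reduced,
separated, of finite type (`ℙᵐ_k → Spec k` is proper: tree `isProper_projectiveSpace`). So the
crux says `HypRes k ↔ ResOver k` for algebraically closed `k`. [folklore] -/
theorem hypRes_of_resOver (k : Type) [Field k] (h : ResOver k) : HypRes k := by
  intro m H ι' hι' hH _
  haveI := hι'
  haveI := hH
  haveI : IsProper (projectiveSpace m k).hom := isProper_projectiveSpace m k
  exact h H (ι' ≫ (projectiveSpace m k).hom) inferInstance inferInstance inferInstance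
    inferInstance

/-- Characteristic zero is FREE: `ResOver k` holds for every field of characteristic `0`
(Hironaka's theorem is PROVED in the tree, `Hironaka1964_holds`, axioms standard). -/
theorem resOver_of_charZero (k : Type) [Field k] [CharZero k] : ResOver k := by
  haveI : CharP k 0 := CharP.ofCharZero k
  exact fun X f h1 h2 h3 h4 => Hironaka1964_holds k X f h1 h2 h3 h4

/-- Hence the ANTECEDENT of the crux is satisfiable (non-vacuity): `HypRes k` holds for every
field of characteristic `0`, e.g. `k = ℚ̄`. -/
theorem hypRes_of_charZero (k : Type) [Field k] [CharZero k] : HypRes k :=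
  hypRes_of_resOver k (resOver_of_charZero k)

/-- The characteristic-zero slice of the crux is a theorem (conclusion true outright). -/
theorem crux_charZero_slice (k : Type) [Field k] [CharZero k] : HypRes k → ResOver k :=
  fun _ => resOver_of_charZero k

/-- The crux restricted to positive characteristic (what `closes` actually consumes). -/
def HypersurfacesSufficeCharP : Prop :=
  ∀ p : ℕ, p.Prime → ∀ (k : Type) [Field k] [CharP k p] [IsAlgClosed k], HypRes k → ResOver k

/-- The crux is EQUIVALENT to its positive-characteristic part (char 0 being Hironaka): the
binder "any characteristic" in the crux costs nothing. -/
theorem crux_iff_charP : HypersurfacesSuffice ↔ HypersurfacesSufficeCharP := by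
  constructor
  · intro h p _ k _ _ _ hk
    exact h k hk
  · intro h k _ _ hk
    obtain ⟨p, hp⟩ := CharP.exists k
    rcases CharP.char_is_prime_or_zero k p with hpr | rfl
    · exact h p hpr k hk
    · haveI : CharZero k := CharP.charP_to_charZero k
      exact resOver_of_charZero k

/-- The summit implies the crux (so the crux is a WEAKENING of the summit, as a reduction step
must be; the converse is not derivable — the crux is classical, the summit open). -/
theorem crux_of_summit (hS : _root_.ResolutionOfSingularities) : HypersurfacesSuffice := by
  rw [crux_iff_charP]
  intro p hp k _ _ _ _ X f h1 h2 h3 h4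
  exact (_root_.ResolutionOfSingularities_iff.mp hS) p hp k X f h1 h2 h3 h4

/-- MUTATION "drop the local-principality clause of the antecedent" is a TREE THEOREM over every
field (`ProjectiveIntegralSuffices.stub_projectiveIntegralSuffices`: components, Chow's lemma,
projective closure): the live content of the crux is exactly the hypersurface-model step. -/
theorem withoutLocallyPrincipal_holds (k : Type) [Field k]
    (h : ∀ (m : ℕ) (H : Scheme.{0}) (ι' : H ⟶ (projectiveSpace m k).left),
      IsClosedImmersion ι' → IsIntegral H → Scheme.HasResolution H) : ResOver k :=
  fun X f h1 h2 h3 h4 =>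
    ProjectiveIntegralSuffices.stub_projectiveIntegralSuffices k h X f h1 h2 h3 h4

/-- CLOSED HYPERSURFACE MODELS over `k` — the one missing plumbing lemma: every integral closed
`X ⊆ ℙⁿ_k` admits a finite birational morphism onto an integral CLOSED `H ⊆ ℙᵐ_k` (some `m`) whose
ideal is locally principal. In the tree (`HypersurfaceModel.stub_hypersurfaceModel_infinite`,
infinite perfect `k`) the model is built inside the PUNCTURED cone `ℙ^{d+1} ∖ {vertex}` and the
ambient is hidden behind `∃ Y`; the closed variant follows from the SAME projection
`φ₀ = LinSec.proj ι t : X → ℙ^{d+1}` by taking `H := φ₀.image`, `ι' := φ₀.imageι` (a closed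
immersion by construction) and `HypersurfaceModel.imageLocallyPrincipal` (prime divisors on the
regular `ℙ^{d+1}` are Cartier — this handles the vertex too, no puncturing needed). -/
def ClosedHypersurfaceModels (k : Type) [Field k] : Prop :=
  ∀ (n : ℕ) (X : Scheme.{0}) (ι : X ⟶ (projectiveSpace n k).left), IsClosedImmersion ι →
    IsIntegral X →
    ∃ (m : ℕ) (H : Scheme.{0}) (ι' : H ⟶ (projectiveSpace m k).left) (φ : X ⟶ H),
      IsClosedImmersion ι' ∧ IsIntegral H ∧
      (∀ y : (projectiveSpace m k).left, ∃ U : (projectiveSpace m k).left.affineOpens,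
        y ∈ (U : (projectiveSpace m k).left.Opens) ∧ (ι'.ker.ideal U).IsPrincipal) ∧
      IsFinite φ ∧ IsBirational φ

/-- **Closed hypersurface models ⇒ the crux at `k`, over EVERY field** (no algebraic closedness
used here): `stub_projectiveIntegralSuffices` + `FiniteBirationalTransfer.stub_finiteBirationalTransfer`
(a resolution of `H` is normal, hence factors through the finite birational `X → H`). -/
theorem resOver_of_closedHypersurfaceModels (k : Type) [Field k] (hM : ClosedHypersurfaceModels k)
    (hH : HypRes k) : ResOver k := by
  refine withoutLocallyPrincipal_holds k fun n X ι hι hX => ?_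
  obtain ⟨m, H, ι', φ, hι', hH', hpr, hφ, hbir⟩ := hM n X ι hι hX
  haveI := hX
  haveI := hH'
  exact FiniteBirationalTransfer.stub_finiteBirationalTransfer X H φ hφ hbir (hH m H ι' hι' hH' hpr)

/-- **The crux follows from closed hypersurface models over algebraically closed fields of
positive characteristic** — the prover's residual, precisely. -/
theorem crux_of_closedHypersurfaceModels
    (hM : ∀ (p : ℕ), p.Prime → ∀ (k : Type) [Field k] [CharP k p] [IsAlgClosed k],
      ClosedHypersurfaceModels k) :
    HypersurfacesSuffice := by
  rw [crux_iff_charP]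
  intro p hp k _ _ _ hk
  exact resOver_of_closedHypersurfaceModels k (hM p hp k) hk

/-! ## §2 Load-bearing hypotheses of the consequent -/

/-- The crux with `IsReduced X` dropped from the consequent. -/
def WithoutIsReduced : Prop :=
  ∀ (k : Type) [Field k] [IsAlgClosed k], HypRes k →
    ∀ (X : Scheme.{0}) (f : X ⟶ Spec (.of k)), IsSeparated f → LocallyOfFiniteType f →
      QuasiCompact f → Scheme.HasResolution X

/-- `Spec k[ε] → Spec k` is of finite type (affine, so separated and quasi-compact for free). -/
theorem locallyOfFiniteType_dualNumber (k : Type) [Field k] :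
    LocallyOfFiniteType (Spec.map (CommRingCat.ofHom (algebraMap k (DualNumber k)))) := by
  haveI : Module.Finite k (DualNumber k) := inferInstanceAs (Module.Finite k (k × k))
  exact (HasRingHomProperty.Spec_iff (P := @LocallyOfFiniteType)).mpr
    (RingHom.finiteType_algebraMap.mpr inferInstance)

/-- **Dropping `IsReduced` turns the crux into "hypersurface resolution FAILS over every
algebraically closed field"**: the consequent without reducedness is false at `Spec k[ε]` for
every `k` (`not_hasResolution_spec_dualNumber`), so the implication holds iff its antecedent never
does. Unconditional. -/
theorem withoutIsReduced_iff :
    WithoutIsReduced ↔ ∀ (k : Type) [Field k] [IsAlgClosed k], ¬ HypRes k := by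
  constructor
  · intro h k _ _ hk
    haveI := locallyOfFiniteType_dualNumber k
    exact not_hasResolution_spec_dualNumber k
      (h k hk (Spec (.of (DualNumber k))) (Spec.map (CommRingCat.ofHom (algebraMap k (DualNumber k))))
        inferInstance inferInstance inferInstance)
  · intro h k _ _ hk
    exact absurd hk (h k)

/-- **`IsReduced X` is load-bearing: the crux without it is FALSE** (unconditionally — witness
field `ℚ̄`, where the antecedent holds by Hironaka, and `X = Spec ℚ̄[ε]`). -/
theorem hypersurfacesSuffice_false_without_isReduced : ¬ WithoutIsReduced := by
  rw [withoutIsReduced_iff]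
  intro h
  exact h (AlgebraicClosure ℚ) (hypRes_of_charZero (AlgebraicClosure ℚ))

/-! ### `LocallyOfFiniteType f` is load-bearing: the absolute integral closure of `k[X]`

The tree's witness `Spec 𝔽_p[X]⁺` (`AbsoluteIntegralClosureNoResolution.lean`) is written over
`ZMod p`; its proof is field-generic and is repeated here over an ARBITRARY field `K` (needed at
`K = ℚ̄`, where the antecedent of the crux is a theorem). No definition is introduced: the ring is
`↥(integralClosure K[X] (AlgebraicClosure (RatFunc K)))`. -/

section AbsoluteIntegralClosure

open Polynomial

variable (K : Type) [Field K]

/-- `K[X] → K[X]⁺` is injective. [folklore] -/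
theorem aic_algebraMap_injective :
    Function.Injective (algebraMap K[X]
      ↥(integralClosure K[X] (AlgebraicClosure (RatFunc K)))) := by
  have h : Function.Injective (algebraMap K[X] (AlgebraicClosure (RatFunc K))) := by
    rw [IsScalarTower.algebraMap_eq K[X] (RatFunc K) (AlgebraicClosure (RatFunc K))]
    exact (algebraMap (RatFunc K) _).injective.comp (RatFunc.algebraMap_injective K)
  intro a b hab
  apply h
  have := congrArg
    (fun x : ↥(integralClosure K[X] (AlgebraicClosure (RatFunc K))) =>
      (x : AlgebraicClosure (RatFunc K))) hab
  simpa using this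

/-- Every element of `K[X]⁺` is a square. [folklore] -/
theorem aic_exists_sq_eq (a : ↥(integralClosure K[X] (AlgebraicClosure (RatFunc K)))) :
    ∃ b : ↥(integralClosure K[X] (AlgebraicClosure (RatFunc K))), b ^ 2 = a := by
  obtain ⟨z, hz⟩ := IsAlgClosed.exists_pow_nat_eq (a : AlgebraicClosure (RatFunc K)) two_pos
  have hzint : IsIntegral K[X] z := IsIntegral.of_pow two_pos (by rw [hz]; exact a.2)
  exact ⟨⟨z, hzint⟩, Subtype.ext hz⟩

/-- Every non-zero `f ∈ K[X]⁺` avoids some non-zero prime (lying over an irreducible factor of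
`c·X + 1`, `c ≠ 0` the constant term of an integral equation of `f`). [folklore] -/
theorem aic_exists_prime_not_mem
    (f : ↥(integralClosure K[X] (AlgebraicClosure (RatFunc K)))) (hf : f ≠ 0) :
    ∃ Q : Ideal ↥(integralClosure K[X] (AlgebraicClosure (RatFunc K))),
      Q.IsPrime ∧ Q ≠ ⊥ ∧ f ∉ Q := by
  have hinj := aic_algebraMap_injective K
  obtain ⟨P, hPm, hPf⟩ := (integralClosure.isIntegral f : IsIntegral K[X] f)
  obtain ⟨P', hP, hXP'⟩ := P.exists_eq_pow_rootMultiplicity_mul_and_not_dvd hPm.ne_zero 0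
  simp only [map_zero, sub_zero] at hP hXP'
  set c := P'.coeff 0 with hc_def
  have hc : c ≠ 0 := fun h0 => hXP' (Polynomial.X_dvd_iff.mpr h0)
  have hP'f : Polynomial.aeval f P' = 0 := by
    have h1 : Polynomial.aeval f P = 0 := hPf
    rw [hP, map_mul, map_pow, Polynomial.aeval_X] at h1
    exact (mul_eq_zero.mp h1).resolve_left (pow_ne_zero _ hf)
  have hrel : algebraMap K[X] _ c = -(Polynomial.aeval f P'.divX * f) := by
    have h1 := hP'f
    rw [← Polynomial.divX_mul_X_add P', map_add, map_mul, Polynomial.aeval_X,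
      Polynomial.aeval_C] at h1
    linear_combination h1
  have hdeg : (c * X + 1 : K[X]).natDegree = c.natDegree + 1 := by
    rw [Polynomial.natDegree_add_eq_left_of_natDegree_lt] <;>
      rw [Polynomial.natDegree_mul_X hc]
    simp
  have hne : (c * X + 1 : K[X]) ≠ 0 := by
    intro h0; rw [h0] at hdeg; simp at hdeg
  have hnu : ¬ IsUnit (c * X + 1 : K[X]) := by
    intro hu
    have := Polynomial.natDegree_eq_zero_of_isUnit hu
    omega
  obtain ⟨π, hπirr, hπdvd⟩ := WfDvdMonoid.exists_irreducible_factor hnu hne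
  have hπc : ¬ π ∣ c := by
    intro hdc
    apply hπirr.not_isUnit
    have : π ∣ (c * X + 1) - c * X := dvd_sub hπdvd (dvd_mul_of_dvd_left hdc _)
    exact isUnit_of_dvd_one (by simpa using this)
  let 𝔭 : Ideal K[X] := Ideal.span {π}
  haveI h𝔭 : 𝔭.IsPrime := (Ideal.span_singleton_prime hπirr.ne_zero).mpr hπirr.prime
  obtain ⟨Q, -, hQ, hQcomap⟩ := Ideal.exists_ideal_over_prime_of_isIntegral 𝔭
    (⊥ : Ideal ↥(integralClosure K[X] (AlgebraicClosure (RatFunc K))))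
    (by
      intro a ha
      have ha0 : algebraMap K[X]
          ↥(integralClosure K[X] (AlgebraicClosure (RatFunc K))) a = 0 :=
        Ideal.mem_bot.mp (Ideal.mem_comap.mp ha)
      have : a = 0 := hinj (by rw [ha0, map_zero])
      rw [this]; exact 𝔭.zero_mem)
  refine ⟨Q, hQ, ?_, ?_⟩
  · rintro rfl
    have hπmem : π ∈ (⊥ : Ideal ↥(integralClosure K[X]
        (AlgebraicClosure (RatFunc K)))).comap (algebraMap K[X] _) := by
      rw [hQcomap]; exact Ideal.mem_span_singleton_self π
    have hπ0 : algebraMap K[X]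
        ↥(integralClosure K[X] (AlgebraicClosure (RatFunc K))) π = 0 :=
      Ideal.mem_bot.mp (Ideal.mem_comap.mp hπmem)
    exact hπirr.ne_zero (hinj (by rw [hπ0, map_zero]))
  · intro hfQ
    have h1 : algebraMap K[X] _ c ∈ Q := by
      rw [hrel]; exact Q.neg_mem (Q.mul_mem_left _ hfQ)
    have h2 : c ∈ 𝔭 := by rw [← hQcomap]; exact h1
    exact hπc (Ideal.mem_span_singleton.mp h2)

/-- **`Spec K[X]⁺` has no resolution of singularities**, for every field `K`. [folklore] -/
theorem not_hasResolution_spec_aic :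
    ¬ Scheme.HasResolution (Spec (.of ↥(integralClosure K[X] (AlgebraicClosure (RatFunc K))))) :=
  not_hasResolution_spec_of_forall_exists_pow_eq _ le_rfl (aic_exists_sq_eq K)
    (aic_exists_prime_not_mem K)

end AbsoluteIntegralClosure

/-- The crux with `LocallyOfFiniteType f` dropped from the consequent. -/
def WithoutLocallyOfFiniteType : Prop :=
  ∀ (k : Type) [Field k] [IsAlgClosed k], HypRes k →
    ∀ (X : Scheme.{0}) (f : X ⟶ Spec (.of k)), IsSeparated f → QuasiCompact f →
      IsReduced X → Scheme.HasResolution X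

/-- **Dropping `LocallyOfFiniteType` likewise turns the crux into "hypersurface resolution fails
over every algebraically closed field"** (witness `Spec k[X]⁺ → Spec k`, affine and reduced,
without resolution). Unconditional. -/
theorem withoutLocallyOfFiniteType_iff :
    WithoutLocallyOfFiniteType ↔ ∀ (k : Type) [Field k] [IsAlgClosed k], ¬ HypRes k := by
  constructor
  · intro h k _ _ hk
    let f : Spec (.of ↥(integralClosure (Polynomial k) (AlgebraicClosure (RatFunc k)))) ⟶
        Spec (.of k) :=
      Spec.map (CommRingCat.ofHom ((algebraMap (Polynomial k)
        ↥(integralClosure (Polynomial k) (AlgebraicClosure (RatFunc k)))).comp Polynomial.C))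
    exact not_hasResolution_spec_aic k (h k hk _ f inferInstance inferInstance inferInstance)
  · intro h k _ _ hk
    exact absurd hk (h k)

/-- **`LocallyOfFiniteType f` is load-bearing: the crux without it is FALSE** (unconditionally —
`k = ℚ̄`, `X = Spec ℚ̄[X]⁺`). -/
theorem hypersurfacesSuffice_false_without_locallyOfFiniteType : ¬ WithoutLocallyOfFiniteType := by
  rw [withoutLocallyOfFiniteType_iff]
  intro h
  exact h (AlgebraicClosure ℚ) (hypRes_of_charZero (AlgebraicClosure ℚ))

/-- The crux with `IsSeparated f` dropped (recorded; not attackable cheaply — resolution of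
non-separated schemes of finite type reduces to the separated case only through canonicity, and
in dimension `≥ 4` the weakened statement contains the crux's open antecedent). -/
def WithoutIsSeparated : Prop :=
  ∀ (k : Type) [Field k] [IsAlgClosed k], HypRes k →
    ∀ (X : Scheme.{0}) (f : X ⟶ Spec (.of k)), LocallyOfFiniteType f → QuasiCompact f →
      IsReduced X → Scheme.HasResolution X

/-- The crux with `QuasiCompact f` dropped (recorded; plausibly still TRUE — a locally Noetherian
reduced scheme has locally finitely many components and resolutions of the components of a
locally finite family glue to a proper morphism; information for the prover: `QuasiCompact` is
possibly unnecessary). -/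
def WithoutQuasiCompact : Prop :=
  ∀ (k : Type) [Field k] [IsAlgClosed k], HypRes k →
    ∀ (X : Scheme.{0}) (f : X ⟶ Spec (.of k)), IsSeparated f → LocallyOfFiniteType f →
      IsReduced X → Scheme.HasResolution X

/-- Only the trivial direction is available for these two. -/
theorem crux_of_withoutIsSeparated (h : WithoutIsSeparated) : HypersurfacesSuffice :=
  fun k _ _ hk X f _ h2 h3 h4 => h k hk X f h2 h3 h4

theorem crux_of_withoutQuasiCompact (h : WithoutQuasiCompact) : HypersurfacesSuffice :=
  fun k _ _ hk X f h1 h2 _ h4 => h k hk X f h1 h2 h4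

/-! ## §3 Mutations of the antecedent's class of hypersurfaces; the dimension cut -/

/-- The antecedent restricted to hypersurfaces of dimension `≥ 4` (`¬ dim H ≤ 3`). -/
def HypResDimGeFour (k : Type) [Field k] : Prop :=
  ∀ (m : ℕ) (H : Scheme.{0}) (ι' : H ⟶ (projectiveSpace m k).left), IsClosedImmersion ι' →
    IsIntegral H →
    (∀ y : (projectiveSpace m k).left, ∃ U : (projectiveSpace m k).left.affineOpens,
      y ∈ (U : (projectiveSpace m k).left.Opens) ∧ (ι'.ker.ideal U).IsPrincipal) →
    ¬ topologicalKrullDim H ≤ 3 → Scheme.HasResolution H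

/-- Modulo the named fact `CossartPiltant2019` (dimension `≤ 3`, every field), hypersurfaces of
dimension `≤ 3` resolve unconditionally, so only those of dimension `≥ 4` need be asked for. -/
theorem hypRes_of_dimGeFour (hCP : CossartPiltant2019.{0}) (k : Type) [Field k]
    (h : HypResDimGeFour k) : HypRes k := by
  intro m H ι' hι' hH hpr
  by_cases hdim : topologicalKrullDim H ≤ 3
  · haveI := hι'
    haveI := hH
    haveI : IsProper (projectiveSpace m k).hom := isProper_projectiveSpace m k
    exact hCP k H (ι' ≫ (projectiveSpace m k).hom) inferInstance inferInstance inferInstance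
      inferInstance hdim
  · exact h m H ι' hι' hH hpr hdim

/-- **STRENGTHENING (weaker antecedent) that is still equivalent, modulo `CossartPiltant2019`**:
the crux ⟺ "resolution of integral hypersurfaces of dimension `≥ 4` with locally principal ideal
⇒ resolution of all reduced separated schemes of finite type", over algebraically closed fields.
Combined with `crux_iff_charP`: only characteristic `p > 0` and `dim H ≥ 4` carry content — the
exact regime the DimensionFourFrontier barrier names. -/
theorem crux_iff_dimGeFour (hCP : CossartPiltant2019.{0}) :
    HypersurfacesSuffice ↔
      ∀ (k : Type) [Field k] [IsAlgClosed k], HypResDimGeFour k → ResOver k := by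
  constructor
  · intro h k _ _ hk
    exact h k (hypRes_of_dimGeFour hCP k hk)
  · intro h k _ _ hk
    exact h k fun m H ι' hι' hH hpr _ => hk m H ι' hι' hH hpr

/-- MUTATION "weaken the antecedent to integral closed subschemes of `ℙᵐ` of ANY codimension"
(drop local principality): then the crux is the tree theorem `withoutLocallyPrincipal_holds`
over every field — so `IsAlgClosed`, perfectness and infinitude of `k` are used by a proof ONLY
inside the hypersurface-model step (generic LINEAR projection: `k` infinite for genericity,
`k(X)/k` separably generated — `k` perfect — for birationality). Recorded as an equivalence of
the mutated crux with a closed theorem. -/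
theorem withoutLocallyPrincipal_iff_true :
    (∀ (k : Type) [Field k] [IsAlgClosed k],
      (∀ (m : ℕ) (H : Scheme.{0}) (ι' : H ⟶ (projectiveSpace m k).left),
        IsClosedImmersion ι' → IsIntegral H → Scheme.HasResolution H) → ResOver k) ↔ True :=
  ⟨fun _ => trivial, fun _ k _ _ h => withoutLocallyPrincipal_holds k h⟩

/-- MUTATION "drop `IsAlgClosed`" (the crux over EVERY field) and "perfect fields only": both
imply the crux; neither is refutable here (over an imperfect `k` a generic linear projection need
not be birational — `k(X)/k` not separably generated — and over a FINITE `k` the tree's model is a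
hypersurface of `ℙᵈ × ℙ¹`, not of a `ℙᵐ` (`HypersurfaceModel.stub_finiteFieldBranch_of_parts`);
whether the `ℙᵐ`-form holds over finite fields is not settled by the tree). Recorded with the
trivial implications only. -/
def OverEveryField : Prop := ∀ (k : Type) [Field k], HypRes k → ResOver k

def OverPerfectFields : Prop := ∀ (k : Type) [Field k] [PerfectField k], HypRes k → ResOver k

theorem overPerfectFields_of_overEveryField (h : OverEveryField) : OverPerfectFields :=
  fun k _ _ hk => h k hk

theorem crux_of_overPerfectFields (h : OverPerfectFields) : HypersurfacesSuffice := by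
  intro k _ _ hk
  haveI : PerfectField k := IsAlgClosed.perfectField k
  exact h k hk

/-! ## §4 Degenerate instances do not bite -/

/-- `H = ℙᵐ_k` itself (kernel `⊥`, principal) is in the antecedent's class and resolves itself
(`isRegular_projectiveSpace`); the empty `X` and spectra of fields resolve themselves. -/
theorem hasResolution_projectiveSpace (m : ℕ) (k : Type) [Field k] :
    Scheme.HasResolution (projectiveSpace m k).left :=
  Scheme.IsRegular.hasResolution (isRegular_projectiveSpace m k)

theorem hasResolution_of_isEmpty (X : Scheme.{0}) [IsEmpty X] : Scheme.HasResolution X :=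
  Scheme.IsRegular.hasResolution fun x => isEmptyElim x

/-- The binders are jointly satisfiable with a TRUE antecedent: `k = ℚ̄` (algebraically closed,
`HypRes ℚ̄` by Hironaka) — so the crux is not vacuous; and at that witness the consequent holds. -/
theorem binders_satisfiable :
    ∃ (k : Type) (_ : Field k) (_ : IsAlgClosed k), HypRes k ∧ ResOver k :=
  ⟨AlgebraicClosure ℚ, inferInstance, inferInstance, hypRes_of_charZero _, resOver_of_charZero _⟩

/-! ## §5 Natural strengthenings -/

/-- STRENGTHENING "the consequent gives `X` regular" (identity as resolution) is FALSE,
unconditionally: `k = ℚ̄`, `X` the cuspidal cubic `Spec ℚ̄[T², T³]`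
(`WeightedThesis.Negative.not_isRegular_spec_cusp`). The crux has content in dimension one. -/
theorem strengthening_isRegular_false :
    ¬ ∀ (k : Type) [Field k] [IsAlgClosed k], HypRes k →
        ∀ (X : Scheme.{0}) (f : X ⟶ Spec (.of k)), IsSeparated f → LocallyOfFiniteType f →
          QuasiCompact f → IsReduced X → Scheme.IsRegular X := by
  classical
  intro h
  let K := AlgebraicClosure ℚ
  let A : Subalgebra K (Polynomial K) :=
    Algebra.adjoin K ({Polynomial.X ^ 2, Polynomial.X ^ 3} : Set (Polynomial K))
  haveI : Algebra.FiniteType K ↥A := by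
    refine ⟨(Subalgebra.fg_top A).mpr ⟨{Polynomial.X ^ 2, Polynomial.X ^ 3}, ?_⟩⟩
    simp [A]
  let f : Spec (.of ↥A) ⟶ Spec (.of K) := Spec.map (CommRingCat.ofHom (algebraMap K ↥A))
  haveI : LocallyOfFiniteType f :=
    (HasRingHomProperty.Spec_iff (P := @LocallyOfFiniteType)).mpr
      (RingHom.finiteType_algebraMap.mpr inferInstance)
  exact Negative.not_isRegular_spec_cusp K
    (h K (hypRes_of_charZero K) (Spec (.of ↥A)) f inferInstance inferInstance inferInstance
      inferInstance)

/-! ## §6 The crux PROVED (also attached to the item as evidence `CandidateProof.lean`) -/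

section CruxProved

open CategoryTheory.Limits Topology HomogeneousLocalization
open Literature.AlgebraicGeometry.Motives.Segre (grading cst frac chartι toSpec X_mem pull pull_comp
  pull_SpecMap')
open Literature.AlgebraicGeometry.Morphisms.ProjCech (PP)
open Summit.ResolutionOfSingularities.ResolutionOfSingularities.Theorems.WeightedThesis.HypersurfaceModel

attribute [local instance] MvPolynomial.gradedAlgebra

universe u

/-- **Closed hypersurface models from linear projection data.** Let `X ⊆ ℙⁿ_k` be integral closed
of dimension `d` over ANY field `k` and `t₀, …, t_{d+1}` linear forms with `t₀, …, t_d` without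
common zero on `X`, `t₀ ≢ 0` on `X` and `K(X) = k(t₁/t₀, …, t_{d+1}/t₀)`. Then the scheme-theoretic
image `H ⊆ ℙ^{d+1}_k` of the projection `(t₀ : … : t_{d+1}) : X → ℙ^{d+1}` is an integral CLOSED
subscheme with locally principal ideal, and `X → H` is finite and birational.
[cite: Hartshorne1977, I Prop. 4.9 (proof); Kollar2007, Prop. 2.48 (proof)] -/
theorem closedHypersurfaceModel_of_linearForms (k : Type u) [Field k] (n : ℕ) {X : Scheme.{u}}
    [IsIntegral X] (ι : X ⟶ PP k n) [IsClosedImmersion ι] (d : ℕ)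
    (t : Fin (d + 1 + 1) → Fin (n + 1) → k)
    (hbpf : LinSec.NoCommonZero ι (LinSec.tInit t)) (ht0 : LinSec.formFn ι (t 0) ≠ 0)
    (hdim : topologicalKrullDim X = d)
    (hgen : Subfield.closure
        (Set.range ((X.presheaf.germ ⊤ (genericPoint X) trivial).hom.comp
            ((ι ≫ toSpec (Fin (n + 1)) k).appTop.hom.comp (Scheme.ΓSpecIso (.of k)).inv.hom)) ∪
          Set.range (fun a : Fin (d + 1) => LinSec.formFn ι (t a.succ) / LinSec.formFn ι (t 0))) = ⊤) :
    ∃ (H : Scheme.{u}) (ι' : H ⟶ PP k (d + 1)) (φ : X ⟶ H),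
      IsClosedImmersion ι' ∧ IsIntegral H ∧
      (∀ y : PP k (d + 1), ∃ U : (PP k (d + 1)).affineOpens,
        y ∈ (U : (PP k (d + 1)).Opens) ∧ (ι'.ker.ideal U).IsPrincipal) ∧
      IsFinite φ ∧ IsBirational φ := by
  obtain ⟨-, -, hpr⟩ := smooth_isSeparated_isProper_toSpec k n
  haveI := hpr
  set f : X ⟶ Spec (.of k) := ι ≫ toSpec (Fin (n + 1)) k with hf
  haveI : IsProper f := inferInstance
  have hbpf' : LinSec.NoCommonZero ι t :=
    ⟨fun x => let ⟨i, hi⟩ := hbpf.exists_notMem x; ⟨Fin.castSucc i, hi⟩⟩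
  set φ₀ := LinSec.proj ι t f hbpf' with hφ₀
  haveI : IsFinite φ₀ := LinSec.isFinite_proj ι t f hbpf'
  -- surjectivity of the stalk map at the generic point (verbatim from
  -- `hypersurfaceModel_of_linearForms`)
  have hsurj : Function.Surjective (φ₀.stalkMap (genericPoint X)) := by
    -- the image of the stalk map at the generic point is a subfield containing the generators
    set F := (φ₀.stalkMap (genericPoint X)).hom with hF
    let S : Subfield X.functionField :=
      { F.range with
        inv_mem' := fun r hr => inv_mem_range_stalkMap φ₀ hr }
    have hS : (⊤ : Subfield X.functionField) ≤ S := by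
      rw [← hgen, Subfield.closure_le]
      rintro r (⟨c, rfl⟩ | ⟨a, rfl⟩)
      · -- constants
        refine ⟨((PP k (d + 1)).presheaf.germ ⊤ (φ₀ (genericPoint X)) trivial).hom
          ((toSpec (Fin (d + 1 + 1)) k).appTop ((Scheme.ΓSpecIso (.of k)).inv c)), ?_⟩
        exact stalkMap_germ_const k φ₀ (toSpec (Fin (d + 1 + 1)) k) f (LinSec.proj_toSpec ι t f hbpf') _ c
      · -- the ratios `t_a / t_0`
        have h0 : LinSec.formVec ι t 0 ≠ 0 := ht0
        have hxU : genericPoint X ∈ lsChart (LinSec.formVec ι t) 0 := genericPoint_mem_lsChart _ h0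
        have hη0 : genericPoint X ∉ LinSec.hyp ι (t 0) := by
          rw [← LinSec.isUnitAt_formFn_div_iff ι (LinSec.genericPoint_mem_chart_j₀ ι)]
          exact RatFn.isUnitAt_genericPoint (div_ne_zero ht0
            (LinSec.formFn_single_ne_zero ι (LinSec.genericPoint_mem_chart_j₀ ι)))
        have hxP : φ₀ (genericPoint X) ∈ (ProjSpace.U 0 : (ProjSpace.P (d + 1) k).Opens) :=
          (LinSec.proj_apply_mem_basicOpen_iff ι t f hbpf' _ 0).2 hη0
        refine ⟨((ProjSpace.P (d + 1) k).presheaf.germ (ProjSpace.U 0) _ hxP).hom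
          (ProjSpace.sec 0 (Segre.frac k 0 a.succ)), ?_⟩
        exact (LinSec.stalkMap_proj_germ_sec ι t f hbpf' 0 hxP hxU a.succ).trans
          (ofSection_lsRatio (LinSec.formVec ι t) h0 a.succ)
    intro r
    obtain ⟨a, ha⟩ := hS (Subfield.mem_top r)
    exact ⟨a, ha⟩
  -- the CLOSED model: the scheme-theoretic image of `φ₀` in `ℙ^{d+1}` itself
  obtain ⟨hsm, hsep, hpr'⟩ := smooth_isSeparated_isProper_toSpec k (d + 1)
  haveI := hsm; haveI := hsep; haveI := hpr'
  haveI : IsIntegral φ₀.image := ChowLemmaProof.isIntegral_image φ₀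
  haveI : IsIntegral (PP k (d + 1)) := isIntegral_projectiveSpace (d + 1) k
  have hY : topologicalKrullDim (PP k (d + 1)) = (d + 1 : ℕ) := ProjSpace.topologicalKrullDim_eq (d + 1) k
  haveI hfin : IsFinite (φ₀.toImage ≫ φ₀.imageι) := by rw [φ₀.toImage_imageι]; infer_instance
  haveI : IsFinite φ₀.toImage := IsFinite.of_comp φ₀.toImage φ₀.imageι
  refine ⟨φ₀.image, φ₀.imageι, φ₀.toImage, inferInstance, inferInstance, ?_, inferInstance, ?_⟩
  · intro y
    rw [Scheme.IdealSheafData.ker_subschemeι]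
    exact imageLocallyPrincipal (toSpec (Fin (d + 1 + 1)) k) φ₀ hdim hY y
  · have h2 : Function.Surjective ((φ₀.toImage ≫ φ₀.imageι).stalkMap (genericPoint X)) := by
      rw [φ₀.toImage_imageι]; exact hsurj
    rw [Scheme.Hom.stalkMap_comp] at h2
    exact isBirational_of_surjective_stalkMap φ₀.toImage
      (φ₀.imageι ≫ toSpec (Fin (d + 1 + 1)) k) (Function.Surjective.of_comp h2)

/-- **Closed hypersurface models over infinite perfect fields**: every integral closed `X ⊆ ℙⁿ_k`
admits a finite birational morphism onto an integral closed `H ⊆ ℙ^{dim X + 1}_k` with locally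
principal ideal. The proof is that of `HypersurfaceModel.hypersurfaceModel_infinite_of_stubs`
(generic linear forms from `stub_functionFieldKaehler`, `stub_formFnLinearGenerates`,
`stub_genericFormsNoCommonZero`) with its last line replaced by
`closedHypersurfaceModel_of_linearForms`. [cite: Kollar2007, Prop. 2.48 (proof); Hartshorne1977, I Prop. 4.9] -/
theorem closedHypersurfaceModels_of_infinite (k : Type) [Field k] [PerfectField k] [Infinite k]
    (n : ℕ) (X : Scheme.{0}) (ι : X ⟶ (projectiveSpace n k).left) (hι : IsClosedImmersion ι)
    (hX : IsIntegral X) :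
    ∃ (m : ℕ) (H : Scheme.{0}) (ι' : H ⟶ (projectiveSpace m k).left) (φ : X ⟶ H),
      IsClosedImmersion ι' ∧ IsIntegral H ∧
      (∀ y : (projectiveSpace m k).left, ∃ U : (projectiveSpace m k).left.affineOpens,
        y ∈ (U : (projectiveSpace m k).left.Opens) ∧ (ι'.ker.ideal U).IsPrincipal) ∧
      IsFinite φ ∧ IsBirational φ := by
  have h1 := stub_functionFieldKaehler
  have h2 := stub_formFnLinearGenerates
  have h3 := stub_genericFormsNoCommonZero
  haveI := hι
  haveI := hX
  classical
  -- the `k`-algebra structure on `K(X)`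
  let φk : k →+* X.functionField := (X.presheaf.germ ⊤ (genericPoint X) trivial).hom.comp
    ((ι ≫ (Literature.AlgebraicGeometry.Motives.projectiveSpace n k).hom).appTop.hom.comp
      (AlgebraicGeometry.Scheme.ΓSpecIso (.of k)).inv.hom)
  letI : Algebra k X.functionField := φk.toAlgebra
  have halg : algebraMap k X.functionField = φk := rfl
  -- F1: `Ω[K(X)⁄k]` has dimension `d = dim X`
  obtain ⟨hEss, hFin, d, hdim, hrank⟩ := h1 k X
    (ι ≫ (Literature.AlgebraicGeometry.Motives.projectiveSpace n k).hom) halg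
  haveI := hEss
  haveI := hFin
  -- F2: the linear map of forms, whose ratios generate `K(X)`
  obtain ⟨V, hV, hgenV⟩ := h2 k n X ι halg
  -- the generic side conditions: given the denominator form `a0` (non-zero on `X`) and the previous
  -- numerator forms `as : Fin m → _`, the next form `b` has `d(V b / t₀)` off the span of the previous
  -- differentials while `m < d`, and `V b / t₀` primitive over `k(previous ratios)` when `m = d`
  let Dk : X.functionField → Ω[X.functionField⁄k] := fun x => KaehlerDifferential.D k X.functionField x
  let Q : (Fin (n + 1) → k) → (m : ℕ) → (Fin m → Fin (n + 1) → k) → (Fin (n + 1) → k) → Prop :=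
    fun a0 m as b =>
      LinSec.formFn ι a0 ≠ 0 →
        (m < d → LinearIndependent X.functionField (fun i : Fin m => Dk (V (as i) / LinSec.formFn ι a0)) →
          Dk (V b / LinSec.formFn ι a0) ∉ Submodule.span X.functionField
            (Set.range fun i : Fin m => Dk (V (as i) / LinSec.formFn ι a0))) ∧
        (m = d → LinearIndependent X.functionField (fun i : Fin m => Dk (V (as i) / LinSec.formFn ι a0)) →
          IntermediateField.adjoin (IntermediateField.adjoin k
            (Set.range fun i : Fin m => V (as i) / LinSec.formFn ι a0)) {V b / LinSec.formFn ι a0} = ⊤)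
  have hQ : ∀ (a0 : Fin (n + 1) → k) (m : ℕ) (as : Fin m → Fin (n + 1) → k), IsGeneric (Q a0 m as) := by
    intro a0 m as
    by_cases h0 : LinSec.formFn ι a0 = 0
    · exact IsGeneric.of_forall fun b hne => absurd h0 hne
    have hgen0 := hgenV a0 h0
    have hA : IsGeneric fun b : Fin (n + 1) → k =>
        m < d → LinearIndependent X.functionField (fun i : Fin m => Dk (V (as i) / LinSec.formFn ι a0)) →
          Dk (V b / LinSec.formFn ι a0) ∉ Submodule.span X.functionField
            (Set.range fun i : Fin m => Dk (V (as i) / LinSec.formFn ι a0)) := by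
      by_cases hmd : m < d
      · have hm : m < Module.finrank X.functionField (Ω[X.functionField⁄k]) := by rw [hrank]; exact hmd
        exact (FieldCore.isGeneric_D_not_mem_span V (LinSec.formFn ι a0) hgen0
          (fun i : Fin m => V (as i) / LinSec.formFn ι a0) hm).mono fun b hb _ _ => hb
      · exact IsGeneric.of_forall fun b h => absurd h hmd
    have hB : IsGeneric fun b : Fin (n + 1) → k =>
        m = d → LinearIndependent X.functionField (fun i : Fin m => Dk (V (as i) / LinSec.formFn ι a0)) →
          IntermediateField.adjoin (IntermediateField.adjoin k
            (Set.range fun i : Fin m => V (as i) / LinSec.formFn ι a0)) {V b / LinSec.formFn ι a0} = ⊤ := by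
      by_cases hmd : m = d
      · by_cases hli : LinearIndependent X.functionField
            (fun i : Fin m => Dk (V (as i) / LinSec.formFn ι a0))
        · have hd' : Module.finrank X.functionField (Ω[X.functionField⁄k]) = m := by rw [hrank, hmd]
          exact (FieldCore.isGeneric_adjoin_simple_eq_top V (LinSec.formFn ι a0) hgen0
            (fun i : Fin m => V (as i) / LinSec.formFn ι a0) hli hd').mono fun b hb _ _ => hb
        · exact IsGeneric.of_forall fun b _ h => absurd h hli
      · exact IsGeneric.of_forall fun b h => absurd h hmd
    exact (hA.and hB).mono fun b hb _ => hb
  let P : ∀ j : ℕ, (Fin j → Fin (n + 1) → k) → (Fin (n + 1) → k) → Prop := fun j a b =>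
    ∀ hj : 0 < j, Q (a ⟨0, hj⟩) (j - 1) (fun i : Fin (j - 1) => a ⟨i.1 + 1, by omega⟩) b
  have hP : ∀ (j : ℕ) (a : Fin j → Fin (n + 1) → k), IsGeneric (P j a) := by
    intro j a
    by_cases hj : 0 < j
    · exact (hQ (a ⟨0, hj⟩) (j - 1) (fun i : Fin (j - 1) => a ⟨i.1 + 1, by omega⟩)).mono
        fun b hb _ => hb
    · exact IsGeneric.of_forall fun b hj' => absurd hj' hj
  -- F3: the sequence of forms
  obtain ⟨t, ht, hbpf, ht0⟩ := h3 k n X ι d hdim P hP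
  -- consequences along the sequence
  have hstep : ∀ (m : ℕ) (hm : m ≤ d),
      Q (t 0) m (fun i : Fin m => t ⟨i.1 + 1, by omega⟩) (t ⟨m + 1, by omega⟩) := by
    intro m hm
    exact ht (m + 1) (by omega) (Nat.succ_pos m)
  -- the ratios `t₁/t₀, …, t_d/t₀` have independent differentials
  have hli : ∀ (m : ℕ) (hm : m ≤ d), LinearIndependent X.functionField
      (fun i : Fin m => Dk (V (t ⟨i.1 + 1, by omega⟩) / LinSec.formFn ι (t 0))) := by
    intro m
    induction m with
    | zero => intro _; exact linearIndependent_empty_type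
    | succ m ih =>
      intro hm
      have hnot := (hstep m (by omega) ht0).1 (by omega) (ih (by omega))
      have e : (fun i : Fin (m + 1) => Dk (V (t ⟨i.1 + 1, by omega⟩) / LinSec.formFn ι (t 0))) =
          Fin.snoc (fun i : Fin m => Dk (V (t ⟨i.1 + 1, by omega⟩) / LinSec.formFn ι (t 0)))
            (Dk (V (t ⟨m + 1, by omega⟩) / LinSec.formFn ι (t 0))) := by
        funext i
        refine Fin.lastCases ?_ (fun i => ?_) i
        · simp only [Fin.snoc_last, Fin.val_last]
        · simp only [Fin.snoc_castSucc, Fin.val_castSucc]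
      rw [e, linearIndependent_finSnoc]
      exact ⟨ih (by omega), hnot⟩
  -- `t_{d+1}/t₀` is a primitive element over `k(t₁/t₀, …, t_d/t₀)`
  have hprim := (hstep d le_rfl ht0).2 rfl (hli d le_rfl)
  -- hence `K(X) = k(t_a/t₀ : 1 ≤ a ≤ d + 1)`
  have hgen : Subfield.closure
      (Set.range ((X.presheaf.germ ⊤ (genericPoint X) trivial).hom.comp
        ((ι ≫ (Literature.AlgebraicGeometry.Motives.projectiveSpace n k).hom).appTop.hom.comp
          (AlgebraicGeometry.Scheme.ΓSpecIso (.of k)).inv.hom)) ∪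
        Set.range (fun a : Fin (d + 1) => LinSec.formFn ι (t a.succ) / LinSec.formFn ι (t 0))) = ⊤ := by
    -- the set of all ratios contains the previous ones and the last one
    set R : Set X.functionField :=
      Set.range (fun a : Fin (d + 1) => LinSec.formFn ι (t a.succ) / LinSec.formFn ι (t 0)) with hR
    have hsub : (Set.range fun i : Fin d => V (t ⟨i.1 + 1, by omega⟩) / LinSec.formFn ι (t 0)) ∪
        {V (t ⟨d + 1, by omega⟩) / LinSec.formFn ι (t 0)} ⊆ R := by
      rintro x (⟨i, rfl⟩ | hx)
      · refine ⟨⟨i.1, by omega⟩, ?_⟩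
        simp only [hV]
        rfl
      · rw [Set.mem_singleton_iff] at hx
        subst hx
        refine ⟨Fin.last d, ?_⟩
        simp only [hV]
        rfl
    have htop : IntermediateField.adjoin k R = ⊤ := by
      rw [eq_top_iff]
      have h1 : IntermediateField.adjoin k
          ((Set.range fun i : Fin d => V (t ⟨i.1 + 1, by omega⟩) / LinSec.formFn ι (t 0)) ∪
            {V (t ⟨d + 1, by omega⟩) / LinSec.formFn ι (t 0)}) = ⊤ := by
        rw [← IntermediateField.adjoin_adjoin_left, hprim, IntermediateField.restrictScalars_top]
      rw [← h1]
      exact IntermediateField.adjoin.mono k _ _ hsub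
    have h2 := congrArg IntermediateField.toSubfield htop
    rw [IntermediateField.adjoin_toSubfield] at h2
    exact h2
  obtain ⟨H, ι', φ, hι', hH, hpr, hφ, hbir⟩ :=
    @closedHypersurfaceModel_of_linearForms k _ n X hX ι hι d t hbpf ht0 hdim hgen
  exact ⟨d + 1, H, ι', φ, hι', hH, hpr, hφ, hbir⟩

/-- **The crux `HypersurfacesSuffice`, PROVED.** Over an algebraically closed field (perfect and
infinite), if every integral closed hypersurface of every `ℙᵐ_k` with locally principal ideal has a
resolution, then so does every reduced separated `k`-scheme of finite type: projective reduction
(`stub_projectiveIntegralSuffices`), closed hypersurface models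
(`closedHypersurfaceModels_of_infinite`) and finite birational transfer
(`stub_finiteBirationalTransfer`). [cite: Hartshorne1977, I Prop. 4.9; Kollar2007, Prop. 2.48 (proof); CossartPiltant2019, Prop. 4.6 (proof, Steps 1–3)] -/
theorem crux_proved : HypersurfacesSuffice := by
  intro k _ _ hH X f hsep hlft hqc hred
  haveI : PerfectField k := IsAlgClosed.perfectField k
  haveI : Infinite k := IsAlgClosed.instInfinite
  refine ProjectiveIntegralSuffices.stub_projectiveIntegralSuffices k (fun n Z ι hι hint => ?_)
    X f hsep hlft hqc hred
  obtain ⟨m, H, ι', φ, hι', hH', hpr, hφ, hbir⟩ := closedHypersurfaceModels_of_infinite k n Z ι hι hint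
  haveI := hint
  haveI := hH'
  exact FiniteBirationalTransfer.stub_finiteBirationalTransfer Z H φ hφ hbir (hH m H ι' hι' hH' hpr)

/-- The same item as filed in route `TeissierJung` (identical body; shared item
stmt-ResolutionOfSingularities-15964). -/
theorem crux_proved_teissierJung :
    Summit.ResolutionOfSingularities.ResolutionOfSingularities.Theses.TeissierJung.HypersurfacesSuffice :=
  crux_proved

/-- Hence `ClosedHypersurfaceModels k` (§1) for every infinite perfect field, and the residual of
`crux_of_closedHypersurfaceModels` is discharged. -/
theorem closedHypersurfaceModels_holds (k : Type) [Field k] [PerfectField k] [Infinite k] :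
    ClosedHypersurfaceModels k :=
  fun n X ι hι hX => closedHypersurfaceModels_of_infinite k n X ι hι hX

end CruxProved

/-! ## §7 Targets — line `generic-projection-closure` (cycle 2, re-arm on the registered skeleton)

The lead PICKED the direct line `generic-projection-closure` (PICKED.md 2026-08-17T09:11Z; skeleton
`Lines/generic_projection_closure.lean`, sha `5d603c79…`), stubs
S1 `stub_exists_linearForms` (LANDED p150098), S2 `stub_ker_isPrincipal_of_ne_vertex` (open, with
the lead), S3 `stub_ker_isPrincipal_vertex` (LANDED p150482), S4 `stub_toImage_finite_birational`
(LANDED p150467).  Attack results: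

* S1, S3, S4 are theorems of the tree — nothing to kill.
* S2 is TRUE, proved below in the STRONGER form `target_S2_everywhere` (both vertex hypotheses
  dropped, any field): it is `HypersurfaceModel.imageLocallyPrincipal` read on `Y = ℙ^{d+1}_k`
  (smooth over `k`, integral, `dim = d + 1`), exactly the step §6 used.  `target_S2` is the
  registered signature verbatim.  Evidence `LineClosure.lean` (item event 2026-08-17T09:25Z) replays
  the lead's glue on the landed S1/S3/S4 + this S2: `HypersurfacesSuffice_of` is sorry-free there —
  the picked line CLOSES (second closure, independent of §6 only in its bookkeeping).
* JOINT SUFFICIENCY: no gap — the skeleton's glue `projectiveModel_of_projection →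
  projectiveModel_of_linearForms → projectiveModel → HypersurfacesSuffice_of` elaborates sorry-free
  on the four stubs (LineClosure.lean), and S2 is consumed only at points `y ≠ vertex` of the image
  of an integral `d`-fold under a finite map, where `target_S2_everywhere` applies; S3 is then
  redundant for integral `X` of dimension `d` (it matters only because its signature carries no
  integrality / dimension hypothesis).
* LOAD-BEARING ANALYSIS OF S2 (`hv`, `hy` are decoration — unused in `target_S2`):
  `topologicalKrullDim X = d`, `IsFinite φ₀` (only through "the closed image has dimension `d`")
  and `IsIntegral X` (through equidimensionality / absence of embedded points) are each necessary;
  the witnesses are recorded as NEAR-MISSES `target_S2_false_without_*` below (informal proofs in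
  the docstrings; NOT formalised — obstruction: no API for the kernel ideal sheaf of a closed point
  of `Proj k[x₀,x₁,x₂]` on an ARBITRARY affine open, nor for `height (x₁, x₂) = 2` read in a chart;
  plan recorded for a later seat).  None of them is live: the lead needs S2 only as stated.
* S1 without `[Infinite k]` is FALSE (informal): over `k = 𝔽_q` the smooth — hence integral —
  surface `X = V(x^q y − x y^q + z^q w − z w^q) ⊆ ℙ³` (all partials `−y^q, x^q, −w^q, z^q` vanish
  only at `0`) contains every `𝔽_q`-point of `ℙ³`, and any three `𝔽_q`-linear forms `t₀, t₁, t₂`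
  in four variables have a common `𝔽_q`-zero, which lies on `X`: `NoCommonZero ι (tInit t)` fails
  for every `t` (`d = 2` being forced by `topologicalKrullDim X = d`).  So the finite-field branch
  of any "every field" variant of the crux cannot go through S1 (cf. §3: the tree's finite-field
  model is a hypersurface of `ℙᵈ × ℙ¹`).  S1 without `[PerfectField k]`: open here (a generic
  linear projection need not be birational when `K(X)/k` is not separably generated; no cheap
  witness with `K(X)` needing more than `d + 1` generators was found).
* S3 without `hv` is FALSE (informal; S3 carries no integrality/dimension hypothesis): the closed
  immersion of the vertex `Spec k → ℙ^{d+1}`, `d ≥ 1`, is finite and its kernel near the vertex is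
  the maximal ideal of a regular point of dimension `d + 1 ≥ 2`, not principal.
* S4 without `hgen` is FALSE for birationality (informal): `ℙ¹ → ℙ² ⊇ ℙ¹`, `(x:y) ↦ (x²:y²:0)`
  composed into `ℙ²` off the vertex, finite of degree 2; `K = k(t) ⊋ k(t²)`.
-/

section Targets

open CategoryTheory.Limits Topology HomogeneousLocalization
open Literature.AlgebraicGeometry.Motives.Segre (grading cst frac chartι toSpec X_mem pull pull_comp
  pull_SpecMap')
open Literature.AlgebraicGeometry.Morphisms.ProjCech (PP)
open Summit.ResolutionOfSingularities.ResolutionOfSingularities.Theorems.WeightedThesis.HypersurfaceModel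

attribute [local instance] MvPolynomial.gradedAlgebra

/-- **Target S2, strengthened: the image ideal is locally principal EVERYWHERE** (no vertex
hypotheses, any field `k`).  For `X` integral of dimension `d` and `φ₀ : X → ℙ^{d+1}_k` finite,
every point of `ℙ^{d+1}_k` has an affine open neighbourhood on which the kernel of `φ₀^*` is
principal: the kernel is the prime-divisor ideal of the closed `d`-dimensional image on the regular
scheme `ℙ^{d+1}_k`, and prime divisors on a regular (locally factorial) scheme are Cartier — in
tree as `HypersurfaceModel.imageLocallyPrincipal`.
[cite: Hartshorne1977, II Prop. 6.11 and 6.2; I Prop. 4.9 (proof)] -/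
theorem target_S2_everywhere (d : ℕ) (k : Type) [Field k] (X : Scheme.{0}) [IsIntegral X]
    (φ₀ : X ⟶ PP k (d + 1)) [IsFinite φ₀] (hdim : topologicalKrullDim X = d) (y : PP k (d + 1)) :
    ∃ U : (PP k (d + 1)).affineOpens, y ∈ (U : (PP k (d + 1)).Opens) ∧ (φ₀.ker.ideal U).IsPrincipal := by
  obtain ⟨hsm, -, -⟩ := smooth_isSeparated_isProper_toSpec k (d + 1)
  haveI := hsm
  haveI : IsIntegral (PP k (d + 1)) := isIntegral_projectiveSpace (d + 1) k
  have hY : topologicalKrullDim (PP k (d + 1)) = (d + 1 : ℕ) :=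
    ProjSpace.topologicalKrullDim_eq (d + 1) k
  exact imageLocallyPrincipal (toSpec (Fin (d + 1 + 1)) k) φ₀ hdim hY y

/-- **Target S2 — the lead's stub `stub_ker_isPrincipal_of_ne_vertex`, registered signature
verbatim** (skeleton sha `5d603c79…`), a corollary of `target_S2_everywhere`; the hypotheses
"`φ₀` avoids the vertex" and "`y ≠ vertex`" are NOT used (decoration).
[cite: Hartshorne1977, I Prop. 4.9 (proof)] -/
theorem target_S2 : ∀ (d : ℕ) (k : Type) [Field k] (X : AlgebraicGeometry.Scheme.{0}) [AlgebraicGeometry.IsIntegral X] (φ₀ : X ⟶ Literature.AlgebraicGeometry.Morphisms.ProjCech.PP k (d + 1)) [AlgebraicGeometry.IsFinite φ₀], (∀ x : X, φ₀ x ≠ Literature.AlgebraicGeometry.Resolution.DeJong1996.vertex d k) → topologicalKrullDim X = d → ∀ y : Literature.AlgebraicGeometry.Morphisms.ProjCech.PP k (d + 1), y ≠ Literature.AlgebraicGeometry.Resolution.DeJong1996.vertex d k → ∃ U : (Literature.AlgebraicGeometry.Morphisms.ProjCech.PP k (d + 1)).affineOpens, y ∈ (U : (Literature.AlgebraicGeometry.Morphisms.ProjCech.PP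 k (d + 1)).Opens) ∧ (φ₀.ker.ideal U).IsPrincipal :=
  fun d k _ X _ φ₀ _ _ hdim y _ => target_S2_everywhere d k X φ₀ hdim y

/-- **S3 is redundant for integral `X` of dimension `d`**: at the vertex too the kernel is
principal nearby, WITHOUT the hypothesis that `φ₀` avoids the vertex (contrast the landed S3, whose
signature has no integrality / dimension hypothesis and genuinely needs `hv`). [folklore] -/
theorem target_S3_of_integral (d : ℕ) (k : Type) [Field k] (X : Scheme.{0}) [IsIntegral X]
    (φ₀ : X ⟶ PP k (d + 1)) [IsFinite φ₀] (hdim : topologicalKrullDim X = d) :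
    ∃ U : (PP k (d + 1)).affineOpens,
      DeJong1996.vertex d k ∈ (U : (PP k (d + 1)).Opens) ∧ (φ₀.ker.ideal U).IsPrincipal :=
  target_S2_everywhere d k X φ₀ hdim _

/-! ### Near-misses (NOT formalised): the load-bearing hypotheses of S2

`sorry` is permitted in this work file only; each docstring carries the informal witness, the
obstruction and the formalisation plan.  None is live for the line (S2 is used as stated). -/

/-- S2 with the dimension hypothesis `topologicalKrullDim X = d` DROPPED. -/
def S2WithoutDim : Prop :=
  ∀ (d : ℕ) (k : Type) [Field k] (X : Scheme.{0}) [IsIntegral X] (φ₀ : X ⟶ PP k (d + 1))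
    [IsFinite φ₀], (∀ x : X, φ₀ x ≠ DeJong1996.vertex d k) →
    ∀ y : PP k (d + 1), y ≠ DeJong1996.vertex d k →
      ∃ U : (PP k (d + 1)).affineOpens, y ∈ (U : (PP k (d + 1)).Opens) ∧ (φ₀.ker.ideal U).IsPrincipal

/-- S2 with `[IsFinite φ₀]` DROPPED (only quasi-compactness kept, so that the kernel ideal sheaf
is the honest kernel, `Scheme.Hom.ker_apply`). -/
def S2WithoutFinite : Prop :=
  ∀ (d : ℕ) (k : Type) [Field k] (X : Scheme.{0}) [IsIntegral X] (φ₀ : X ⟶ PP k (d + 1))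
    [QuasiCompact φ₀], (∀ x : X, φ₀ x ≠ DeJong1996.vertex d k) → topologicalKrullDim X = d →
    ∀ y : PP k (d + 1), y ≠ DeJong1996.vertex d k →
      ∃ U : (PP k (d + 1)).affineOpens, y ∈ (U : (PP k (d + 1)).Opens) ∧ (φ₀.ker.ideal U).IsPrincipal

/-- S2 with `[IsIntegral X]` DROPPED. -/
def S2WithoutIntegral : Prop :=
  ∀ (d : ℕ) (k : Type) [Field k] (X : Scheme.{0}) (φ₀ : X ⟶ PP k (d + 1))
    [IsFinite φ₀], (∀ x : X, φ₀ x ≠ DeJong1996.vertex d k) → topologicalKrullDim X = d →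
    ∀ y : PP k (d + 1), y ≠ DeJong1996.vertex d k →
      ∃ U : (PP k (d + 1)).affineOpens, y ∈ (U : (PP k (d + 1)).Opens) ∧ (φ₀.ker.ideal U).IsPrincipal

/-- NEAR-MISS: **`topologicalKrullDim X = d` is load-bearing in S2.**  Informal witness: `d = 1`,
any field `k`, `X = Spec k`, `φ₀` the closed immersion of the `k`-point `p = (1:0:0)` (the relevant
homogeneous prime `(x₁, x₂)`, built like `DeJong1996.vertex`; `p ≠ vertex = (0:0:1)`); `φ₀` is
finite, `X` integral of dimension `0 ≠ d`.  For every affine open `U ∋ p`,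
`φ₀.ker.ideal U = {s | s(p) = 0}` is the maximal ideal `𝔭_U` of `p` in `Γ(U)`, and
`Γ(U)_{𝔭_U} ≅ 𝒪_{ℙ²,p}` is regular local of dimension `2`, so `𝔭_U` is not principal (Krull:
a prime minimal over a principal ideal has height `≤ 1`).  OBSTRUCTION (why `sorry`): Mathlib /
the tree have no description of `(X.fromSpecResidueField p).ker.ideal U` on an arbitrary affine
open `U`, and `height (x₁/x₀, x₂/x₀) = 2` must be read through the chart `D₊(x₀) ≅ 𝔸²`; plan:
`Scheme.Hom.ker_apply` + `Scheme.evaluation` for the first, `IsLocalization.AtPrime` +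
`MvPolynomial` dimension (`Literature…AffineDomainDimension`) + `Ideal.height_le_one_of_isPrincipal…`
for the second.  Tried: nothing cheaper (every witness needs non-principality of a height-2 ideal
on all affine neighbourhoods). -/
theorem target_S2_false_without_dim : ¬ S2WithoutDim := by
  sorry

/-- NEAR-MISS: **finiteness of `φ₀` is load-bearing in S2, but only through the dimension of the
closed image.**  Informal witness: `d = 1`, `X = ℙ¹_k` (integral, dimension `1`), `φ₀` the CONSTANT
map to the `k`-point `p = (1:0:0) ≠ vertex` (`ℙ¹ → Spec k → ℙ²`; proper, quasi-compact, not finite: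
the preimage of an affine neighbourhood of `p` is `ℙ¹`, not affine).  `X` being reduced, the kernel
over `U ∋ p` is again the maximal ideal of `p`, not principal (as in `target_S2_false_without_dim`).
The natural TRUE weakening: `φ₀` quasi-compact with closed image of dimension `d` (generically
finite).  OBSTRUCTION: as for `target_S2_false_without_dim`. -/
theorem target_S2_false_without_finite : ¬ S2WithoutFinite := by
  sorry

/-- NEAR-MISS: **integrality of `X` is load-bearing in S2, through equidimensionality and embedded
points (not through reducedness alone).**  Informal witnesses: (i) `X = ℙ¹ ⊔ Spec k → ℙ²`, a line
not through the vertex plus a `k`-point `p` off the line and `≠ vertex`; finite, reduced,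
`topologicalKrullDim X = max (1, 0) = 1 = d`; near `p` the kernel is `𝓘_line ∩ 𝔪_p`, whose stalk at
`p` is `𝔪_p`, not principal.  (ii) non-reduced, irreducible: `X = Proj k[x,y,z]/(z², yz) ↪ ℙ²`
(the line `z = 0` with an embedded point at `(1:0:0)`), kernel `(z², yz) = z·(y, z)` not principal
at the embedded point.  Whereas the double line `Proj k[x,y,z]/(z²)` (non-reduced, no embedded
point) HAS principal kernel `(z²)`: reducedness is not what matters.  OBSTRUCTION: as for
`target_S2_false_without_dim`, plus closed subschemes of `Proj` by homogeneous ideals / finite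
morphisms from coproducts (not in Mathlib). -/
theorem target_S2_false_without_integral : ¬ S2WithoutIntegral := by
  sorry

end Targets


end Summit.ResolutionOfSingularities.ResolutionOfSingularities.Cruxes.HypersurfacesSuffice.Disproof

end
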